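import Literature.NumberTheory.EllipticCurves.ZpExtensionShapiroToEisenstein
import HarnessLib

/-!
# Multiplication by `p^{a−b}`, `E[p^a] → E[p^b]`, as an intertwining map for ALL `b ≤ a` (no index arithmetic in types),
# its effect on the compact Selmer levels of `𝔖_p(K_∞)`, and the CAST-FREE form of the reindexed pushforward hook
# `H¹(Λ/I_σ ↠ A_{m,k} ⊗ p^{σ−k} ·) (Φ z)_σ = proj_k (compact control map of z)` for every Shapiro level `σ ≥ k`
# (definitions with bodies + theorems)

Topic `NumberTheory/EllipticCurves` (sequel of `ZpExtensionShapiroToEisenstein`). Cell `pub/bsd-print-x9`, seat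
`bsd-line-x9-p2` (g3): STUB 2 of the shared μ-item (crux stmt-BirchSwinnertonDyer-22642). A `CoeffTowerSetting.Hom` out of a
REINDEXED source `S_Λ.reindex s₀ d` (lit `TowerReindex`: levels `σ k = idxSeq s₀ d k`) needs level maps
`E[p^{σ k}] ⊗ Λ/I_{σ k} → E[p^{k'}] ⊗ A_{m,k'}` whose `E`-part `E[p^{σ k}] → E[p^{k'}]` must typecheck for an ARBITRARY index
expression `σ k ≥ k'` — the iterate `torsionReduceIter t k d` of `…ToCoeffTwistH1Iterate` has source index literally `k + d`.
This file supplies the direct map `P ↦ p^{a−b} P` for any `b ≤ a` and re-proves the hook in that currency.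

* `WeierstrassCurve.geomTorsionPowReduce W p a b h : E[p^a] →+ E[p^b]`, `torsionGaloisModulePowReduce W p a b h : E[p^a] →ⁱL E[p^b]`
  (`coe_…` : value `p^{a−b} • P`); `torsionGaloisModulePowReduce_self` (= id pointwise), `_succ_eq_comp` (one more step =
  composite with the lift `t` of `p ·`);
* `LambdaAdicSelmerData.cohomologyMap_torsionGaloisModulePowReduce_proj` : `H¹(Γ_n, p^{a−b} ·) (proj n s)_a = (proj n s)_b`;
* `LambdaAdicSelmerData.map_coeffTwistReduce_coeffComponent_powReduce` : `H¹(φ ⊗ p^{a−b} ·) ∘ comp_{A,a} = comp_{A′,b}`;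
* **`ZpExtension.shapiroToEisensteinTwistLe κ hm σ k hσ hle : E[p^σ] ⊗ (Λ/(ω_σ,p^σ))(χ) →ⁱL E[p^k] ⊗ A_{m,k}(χ)`** and
  **`map_shapiroToEisensteinTwistLe_toShapiroLimitH1[_eq_proj_toEisensteinH1]`**: for every `σ ≥ k` with
  `(ω_σ, p^σ) ≤ (q_m, p^k)`, `H¹(f_σ) (Φ z)_σ = eisensteinComponent D hm k n z = I.proj k (D.toEisensteinH1 … z)`.
DEFINITIONS WITH BODIES + theorems; no named fact, no instance, no notation, no `sorry`. BSD is not proved by any of this.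

References: [Howard2004HeegnerKolyvagin] B. Howard, Compositio Math. 140 (2004), Rem. 1.2.4, Lemma 2.2.7, proof of Thm. 2.2.10
(arXiv Thm. 3.2.10, p0017 L78–81), §1.6 (arXiv p. 12, L29–33); [PerrinRiou1987BSMF] §0 p. 401; [SilvermanAEC2009] III.§7.
-/

noncomputable section

open scoped Topology Classical ContRepresentation
open Field CategoryTheory IsLocalRing

/-! ## §1 `P ↦ p^{a−b} P : E[p^a] → E[p^b]` -/

namespace WeierstrassCurve

open Literature.NumberTheory.EllipticCurves Literature.NumberTheory.GaloisRepresentations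

section Pow

variable {K : Type} [Field K] (W : WeierstrassCurve K) (p : ℕ)

/-- **Multiplication by `p^{a−b}`, `E[p^a] → E[p^b]`** (`b ≤ a`), additive. [cite: SilvermanAEC2009, III.§7 (T_p E = lim E[p^k] along [p])]
[cite: PerrinRiou1987BSMF, §0 p. 401] -/
def geomTorsionPowReduce (a b : ℕ) (h : b ≤ a) : geomTorsion W ((p : ℤ) ^ a) →+ geomTorsion W ((p : ℤ) ^ b) :=
  ((zsmulAddGroupHom (α := geomPoints W) ((p : ℤ) ^ (a - b))).comp
    (geomTorsion W ((p : ℤ) ^ a)).subtype).codRestrict (geomTorsion W ((p : ℤ) ^ b)) fun P ↦ by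
      rw [mem_geomTorsion_iff, AddMonoidHom.coe_comp, Function.comp_apply, AddSubgroup.coe_subtype,
        zsmulAddGroupHom_apply, smul_smul, ← pow_add, Nat.add_sub_cancel' h, ← mem_geomTorsion_iff]
      exact P.2

/-- Values of `geomTorsionPowReduce`: `p^{a−b} • P`. [cite: SilvermanAEC2009, III.§7] -/
@[simp] theorem coe_geomTorsionPowReduce (a b : ℕ) (h : b ≤ a) (P : geomTorsion W ((p : ℤ) ^ a)) :
    ((W.geomTorsionPowReduce p a b h P : geomTorsion W ((p : ℤ) ^ b)) : geomPoints W) =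
      (p : ℤ) ^ (a - b) • (P : geomPoints W) :=
  rfl

/-- **Multiplication by `p^{a−b}`, `E[p^a] → E[p^b]`, as a continuous `Γ_K`-intertwining map** of the discrete Galois modules
`torsionGaloisModule` — for ALL `b ≤ a` (the `E`-part of the level maps of a `Hom` out of a reindexed `Λ`-adic source).
[cite: SilvermanAEC2009, III.§7] [cite: Howard2004HeegnerKolyvagin, Rem. 1.2.4 and §1.6 (arXiv p. 12, L29–33)] -/
def torsionGaloisModulePowReduce (a b : ℕ) (h : b ≤ a) :
    (W.torsionGaloisModule ((p : ℤ) ^ a)).toContRepresentation →ⁱL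
      (W.torsionGaloisModule ((p : ℤ) ^ b)).toContRepresentation where
  toContinuousLinearMap := ⟨(W.geomTorsionPowReduce p a b h).toIntLinearMap, continuous_of_discreteTopology⟩
  isIntertwining' σ := by
    ext P
    change (p : ℤ) ^ (a - b) • ((σ • P : geomTorsion W ((p : ℤ) ^ a)) : geomPoints W) =
      σ • ((p : ℤ) ^ (a - b) • (P : geomPoints W))
    rw [Literature.NumberTheory.EllipticCurves.AddSubgroup.torsionBy.coe_smul, smul_zsmul_geomPoints]

/-- Values of `torsionGaloisModulePowReduce`: `p^{a−b} • P`. [cite: SilvermanAEC2009, III.§7] -/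
@[simp] theorem coe_torsionGaloisModulePowReduce (a b : ℕ) (h : b ≤ a) (P : geomTorsion W ((p : ℤ) ^ a)) :
    ((W.torsionGaloisModulePowReduce p a b h P : geomTorsion W ((p : ℤ) ^ b)) : geomPoints W) =
      (p : ℤ) ^ (a - b) • (P : geomPoints W) :=
  rfl

/-- At `a = b` the map is the identity. [cite: SilvermanAEC2009, III.§7] -/
theorem torsionGaloisModulePowReduce_self (a : ℕ) (P : geomTorsion W ((p : ℤ) ^ a)) :
    W.torsionGaloisModulePowReduce p a a le_rfl P = P :=
  Subtype.ext (by rw [coe_torsionGaloisModulePowReduce, Nat.sub_self, pow_zero, one_smul])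

/-- **One more step is the composite with a lift of `p ·`**: for `t : E[p^{a+1}] → E[p^a]` with values `geomTorsionReduce`,
`p^{a+1−b} · = (p^{a−b} ·) ∘ t` as intertwining maps. [cite: SilvermanAEC2009, III.§7] -/
theorem torsionGaloisModulePowReduce_succ_eq_comp (a b : ℕ) (h : b ≤ a)
    (t : (W.torsionGaloisModule ((p : ℤ) ^ (a + 1))).toContRepresentation →ⁱL
      (W.torsionGaloisModule ((p : ℤ) ^ a)).toContRepresentation)
    (ht : ∀ P, t P = W.geomTorsionReduce p a P) :
    W.torsionGaloisModulePowReduce p (a + 1) b (h.trans (Nat.le_succ a)) =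
      (W.torsionGaloisModulePowReduce p a b h).comp t := by
  refine ContIntertwiningMap.ext (ContinuousLinearMap.ext fun P ↦ Subtype.ext ?_)
  change (p : ℤ) ^ (a + 1 - b) • (P : geomPoints W) = (p : ℤ) ^ (a - b) • ((t P : geomTorsion W ((p : ℤ) ^ a)) : geomPoints W)
  rw [ht, coe_geomTorsionReduce, smul_smul, ← pow_succ, Nat.sub_add_comm h]

end Pow

end WeierstrassCurve

/-! ## §2 On the compact Selmer levels of `𝔖_p(K_∞)` -/

namespace WeierstrassCurve.LambdaAdicSelmerData

open Literature.NumberTheory.EllipticCurves Literature.NumberTheory.GaloisRepresentations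

variable {K : Type} [Field K] [NumberField K] {V : WeierstrassCurve K} [V.IsElliptic] {p : ℕ} [hp : Fact p.Prime]
  {κ : ZpExtension K p} {γ : absoluteGaloisGroup K} (D : V.LambdaAdicSelmerData κ γ)
  (t : ∀ k, (V.torsionGaloisModule ((p : ℤ) ^ (k + 1))).toContRepresentation →ⁱL
    (V.torsionGaloisModule ((p : ℤ) ^ k)).toContRepresentation)
  (ht : ∀ k (P : geomTorsion V ((p : ℤ) ^ (k + 1))), t k P = V.geomTorsionReduce p k P)

include ht in
omit [V.IsElliptic] in
/-- **`H¹(Γ_n, p^{a−b} ·) (proj n s)_a = (proj n s)_b`** for `s ∈ 𝔖_p(K_∞)` and every `b ≤ a` (induction on `a − b` through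
`torsionGaloisModulePowReduce_succ_eq_comp` and the `p_*`-compatibility of the compact Selmer families).
[cite: PerrinRiou1987BSMF, §0 p. 401 (S_p(L) = lim← S(L)^{(p^k)} along multiplication by p)] -/
theorem cohomologyMap_torsionGaloisModulePowReduce_proj (n a b : ℕ) (h : b ≤ a) (s : D.S) :
    cohomologyMap (subgroupRepHom (TopRep.ofHom ⟨(V.torsionGaloisModulePowReduce p a b h).toContinuousLinearMap,
      (V.torsionGaloisModulePowReduce p a b h).isIntertwining'⟩) (κ.layerSubgroup n)) 1 (D.proj n s a) = D.proj n s b := by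
  obtain ⟨d, rfl⟩ := Nat.exists_eq_add_of_le h
  induction d with
  | zero =>
    exact cohomologyMap_subgroupRepHom_eq_self_of_forall_eq b (V.torsionGaloisModulePowReduce p (b + 0) b h)
      (fun P ↦ V.torsionGaloisModulePowReduce_self p b P) _ _
  | succ d ih =>
    change cohomologyMap (subgroupRepHom (TopRep.ofHom
      ⟨(V.torsionGaloisModulePowReduce p (b + d + 1) b ((Nat.le_add_right b d).trans (Nat.le_succ _))).toContinuousLinearMap,
        (V.torsionGaloisModulePowReduce p (b + d + 1) b ((Nat.le_add_right b d).trans (Nat.le_succ _))).isIntertwining'⟩)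
      (κ.layerSubgroup n)) 1 (D.proj n s (b + d + 1)) = D.proj n s b
    rw [V.torsionGaloisModulePowReduce_succ_eq_comp p (b + d) b (Nat.le_add_right b d) (t (b + d)) (ht (b + d)),
      cohomologyMap_subgroupRepHom_comp, cohomologyMap_subgroupRepHom_eq_reduceTorsionH1 t ht (b + d),
      ((V.mem_compactSelmerOver_iff (κ.layerSubgroup n) p (D.proj n s)).1 (D.proj_mem n s)).2 (b + d),
      ih (Nat.le_add_right b d)]

section Hook

variable {A : Type} [CommRing A] {u : A} {J : ℕ} (hu : u ^ (p ^ J) = 1)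
  {A' : Type} [CommRing A'] {u' : A'} {J' : ℕ} (hu' : u' ^ (p ^ J') = 1) (φ : A →+* A') (hφ : φ u = u')

include ht in
omit [V.IsElliptic] in
/-- **`H¹(φ ⊗ p^{a−b} ·) ∘ comp_{A, a} = comp_{A′, b}`** at every layer `n` above `J` and `J′` (cast-free twin of
`map_coeffTwistReduce_coeffComponent_reduceIter`). [cite: Howard2004HeegnerKolyvagin, Rem. 1.2.4 and proof of Thm. 2.2.10 (arXiv p0017 L78–81)] -/
theorem map_coeffTwistReduce_coeffComponent_powReduce (a b n : ℕ) (h : b ≤ a) (hn : J ≤ n) (hn' : J' ≤ n) (s : D.S) :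
    galoisCohomology.map ((κ.unitTwist (-1)).coeffTwistReduce hu hu' φ hφ (V.torsionGaloisModulePowReduce p a b h)) 1
        (D.coeffComponent hu a n hn s) = D.coeffComponent hu' b n hn' s := by
  haveI := κ.fintypeQuotientLayer n
  rw [coeffComponent_apply, coeffComponent_apply,
    (κ.unitTwist (-1)).map_coeffTwistReduce_coresCoeff hu hu' φ hφ (V.torsionGaloisModulePowReduce p a b h)
      (κ.layerSubgroup n) (layerSubgroup_le_unitTwist_layerSubgroup_of_le hn)
      (layerSubgroup_le_unitTwist_layerSubgroup_of_le hn') (κ.isOpen_layerSubgroup n),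
    D.cohomologyMap_torsionGaloisModulePowReduce_proj t ht n a b h s]

end Hook

end WeierstrassCurve.LambdaAdicSelmerData

/-! ## §3 The cast-free level maps of the reindexed pushforward and the hook on `Φ` -/

namespace Literature.NumberTheory.EllipticCurves.ZpExtension

open Literature.NumberTheory.GaloisRepresentations

variable {K : Type} [Field K] [NumberField K] {V : WeierstrassCurve K} [V.IsElliptic] {p : ℕ} [hp : Fact p.Prime]
  (κ : ZpExtension K p)
  (t : ∀ k, (V.torsionGaloisModule ((p : ℤ) ^ (k + 1))).toContRepresentation →ⁱL
    (V.torsionGaloisModule ((p : ℤ) ^ k)).toContRepresentation)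
  {m : ℕ} (hm : 1 ≤ m)

variable (V) in
/-- **The level map `E[p^σ] ⊗ (Λ/(ω_σ, p^σ))(χ) → E[p^k] ⊗ A_{m,k}(χ)` for ANY Shapiro level `σ ≥ k`** with
`(ω_σ, p^σ) ≤ (q_m, p^k)` (coefficients `shapiroToEisensteinCoeff`, module part `p^{σ−k} ·`): the `f k` of a `Hom` out of a
reindexed source `S_Λ.reindex s₀ d` at `σ = idxSeq s₀ d k`, with no arithmetic in the types.
[cite: Howard2004HeegnerKolyvagin, Rem. 1.2.4, Lemma 2.2.7 and proof of Thm. 2.2.10 (arXiv p0017 L78–81)] -/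
def shapiroToEisensteinTwistLe (σ k : ℕ) (hσ : k ≤ σ)
    (hle : shapiroIdeal p σ ≤ Ideal.span {(PowerSeries.X ^ m + PowerSeries.C (p : ℤ_[p]) : IwasawaAlgebra p)} ⊔
      Ideal.span {PowerSeries.C ((p : ℤ_[p]) ^ k)}) :
    (κ.coeffTwist (V.torsionGaloisModule ((p : ℤ) ^ σ)) (coeffLevelUnit (shapiroIdeal p) σ) σ
        (mk_one_add_X_pow_prime_pow_eq_one (shapiroIdeal p σ) (omega_mem_shapiroIdeal p σ))).toContRepresentation →ⁱL
      (κ.eisensteinTwist (V.torsionGaloisModule ((p : ℤ) ^ k)) hm k).toContRepresentation :=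
  κ.coeffTwistReduce (mk_one_add_X_pow_prime_pow_eq_one (shapiroIdeal p σ) (omega_mem_shapiroIdeal p σ))
    (onePlusT_pow_prime_pow_eisensteinLevel (p := p) hm k) (shapiroToEisensteinCoeff p hle)
    (shapiroToEisensteinCoeff_coeffLevelUnit p hle) (V.torsionGaloisModulePowReduce p σ k hσ)

omit [NumberField K] [V.IsElliptic] in
/-- `shapiroToEisensteinTwistLe` on pure tensors: `c ⊗ P ↦ [c] ⊗ p^{σ−k} P`. [cite: Howard2004HeegnerKolyvagin, Rem. 1.2.4] -/
theorem shapiroToEisensteinTwistLe_tmul (σ k : ℕ) (hσ : k ≤ σ)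
    (hle : shapiroIdeal p σ ≤ Ideal.span {(PowerSeries.X ^ m + PowerSeries.C (p : ℤ_[p]) : IwasawaAlgebra p)} ⊔
      Ideal.span {PowerSeries.C ((p : ℤ_[p]) ^ k)}) (c : IwasawaAlgebra p ⧸ shapiroIdeal p σ)
    (P : WeierstrassCurve.geomTorsion V ((p : ℤ) ^ σ)) :
    κ.shapiroToEisensteinTwistLe V hm σ k hσ hle (QuotTwisted.tmul c P) =
      IwasawaAlgebra.EisensteinCoeff.Twisted.tmul (shapiroToEisensteinCoeff p hle c)
        (V.torsionGaloisModulePowReduce p σ k hσ P) :=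
  κ.coeffTwistReduce_tmul _ _ _ _ _ c P

omit [NumberField K] [V.IsElliptic] in
/-- `shapiroToEisensteinTwistLe` is semilinear over `Λ/I_σ → A_{m,k}`. [cite: Howard2004HeegnerKolyvagin, Rem. 1.2.4 (i)] -/
theorem shapiroToEisensteinTwistLe_smul (σ k : ℕ) (hσ : k ≤ σ)
    (hle : shapiroIdeal p σ ≤ Ideal.span {(PowerSeries.X ^ m + PowerSeries.C (p : ℤ_[p]) : IwasawaAlgebra p)} ⊔
      Ideal.span {PowerSeries.C ((p : ℤ_[p]) ^ k)}) (c : IwasawaAlgebra p ⧸ shapiroIdeal p σ)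
    (x : QuotTwisted (IwasawaAlgebra p ⧸ shapiroIdeal p σ) (WeierstrassCurve.geomTorsion V ((p : ℤ) ^ σ))) :
    κ.shapiroToEisensteinTwistLe V hm σ k hσ hle (c • x) =
      shapiroToEisensteinCoeff p hle c • κ.shapiroToEisensteinTwistLe V hm σ k hσ hle x :=
  κ.coeffTwistReduce_smul _ _ _ _ _ c x

omit [NumberField K] [V.IsElliptic] in
/-- `shapiroToEisensteinTwistLe` is surjective when `p^{σ−k} · : E[p^σ] → E[p^k]` is (e.g. `E(K̄)` `p`-divisible).
[cite: Howard2004HeegnerKolyvagin, §1.6 (surjective reductions)] -/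
theorem shapiroToEisensteinTwistLe_surjective (σ k : ℕ) (hσ : k ≤ σ)
    (hle : shapiroIdeal p σ ≤ Ideal.span {(PowerSeries.X ^ m + PowerSeries.C (p : ℤ_[p]) : IwasawaAlgebra p)} ⊔
      Ideal.span {PowerSeries.C ((p : ℤ_[p]) ^ k)})
    (hs : Function.Surjective (V.torsionGaloisModulePowReduce p σ k hσ)) :
    Function.Surjective (κ.shapiroToEisensteinTwistLe V hm σ k hσ hle) :=
  κ.coeffTwistReduce_surjective _ _ _ _ _ (shapiroToEisensteinCoeff_surjective p hle) hs

variable {κ} {γ : absoluteGaloisGroup K} (D : V.LambdaAdicSelmerData κ γ)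
  (ht : ∀ k (P : WeierstrassCurve.geomTorsion V ((p : ℤ) ^ (k + 1))), t k P = V.geomTorsionReduce p k P)
  (hts : ∀ k, Function.Surjective (t k))

include ht in
omit [V.IsElliptic] in
/-- **`H¹(f_σ) ∘ comp_σ = eisensteinComponent_k`** on the source level maps of `𝔖` at any common layer `n`.
[cite: Howard2004HeegnerKolyvagin, proof of Thm. 2.2.10 (arXiv p0017 L78–81)] -/
theorem map_shapiroToEisensteinTwistLe_coeffComponent (σ k n : ℕ) (hσ : k ≤ σ) (hn : σ ≤ n)
    (hn' : eisensteinLevel (p := p) hm k ≤ n)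
    (hle : shapiroIdeal p σ ≤ Ideal.span {(PowerSeries.X ^ m + PowerSeries.C (p : ℤ_[p]) : IwasawaAlgebra p)} ⊔
      Ideal.span {PowerSeries.C ((p : ℤ_[p]) ^ k)}) (z : D.S) :
    galoisCohomology.map ((κ.unitTwist (-1)).shapiroToEisensteinTwistLe V hm σ k hσ hle) 1
        (D.coeffComponent (mk_one_add_X_pow_prime_pow_eq_one (shapiroIdeal p σ) (omega_mem_shapiroIdeal p σ)) σ n hn z) =
      D.eisensteinComponent hm k n hn' z :=
  D.map_coeffTwistReduce_coeffComponent_powReduce t ht _ _ (shapiroToEisensteinCoeff p hle)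
    (shapiroToEisensteinCoeff_coeffLevelUnit p hle) σ k n hσ hn hn' z

/-- **On the comparison `Φ`, cast-free: `H¹(f_σ) (Φ z)_σ = eisensteinComponent D hm k n z`** for every Shapiro level
`σ ≥ k` with `(ω_σ, p^σ) ≤ (q_m, p^k)`. [cite: Howard2004HeegnerKolyvagin, proof of Thm. 2.2.10 (arXiv p0017 L78–81)] -/
theorem map_shapiroToEisensteinTwistLe_toShapiroLimitH1 (hγ : κ.IsTopGenerator γ)
    (hE : ∀ P : V.toAffine.Point, p • P = 0 → P = 0) (σ k n : ℕ) (hσ : k ≤ σ) (hn : σ ≤ n)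
    (hn' : eisensteinLevel (p := p) hm k ≤ n)
    (hle : shapiroIdeal p σ ≤ Ideal.span {(PowerSeries.X ^ m + PowerSeries.C (p : ℤ_[p]) : IwasawaAlgebra p)} ⊔
      Ideal.span {PowerSeries.C ((p : ℤ_[p]) ^ k)}) (z : D.S) :
    galoisCohomology.map ((κ.unitTwist (-1)).shapiroToEisensteinTwistLe V hm σ k hσ hle) 1
        ((D.toShapiroLimitH1 t ht hts hγ hE z).1 σ) = D.eisensteinComponent hm k n hn' z := by
  change galoisCohomology.map ((κ.unitTwist (-1)).shapiroToEisensteinTwistLe V hm σ k hσ hle) 1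
      (D.coeffComponent (mk_one_add_X_pow_prime_pow_eq_one (shapiroIdeal p σ) (omega_mem_shapiroIdeal p σ)) σ σ le_rfl z) = _
  rw [← D.coeffComponent_eq_self _ hγ hE σ hn z]
  exact map_shapiroToEisensteinTwistLe_coeffComponent t hm D ht σ k n hσ hn hn' hle z

/-- **`H¹(f_σ) (Φ z)_σ = proj_k (compact control map of z)`** (pinned `H¹(K, T_𝔮)` datum `I`), for every Shapiro level
`σ ≥ k` with `(ω_σ, p^σ) ≤ (q_m, p^k)` — the identity «`one′ k = H¹(f k)(one (σ k))` is D1's control map on `z`» for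
the REINDEXED pushforward, with no arithmetic in the types. [cite: Howard2004HeegnerKolyvagin, proof of Thm. 2.2.10 (arXiv p0017 L78–81)] -/
theorem map_shapiroToEisensteinTwistLe_toShapiroLimitH1_eq_proj_toEisensteinH1 (hγ : κ.IsTopGenerator γ)
    (hE : ∀ P : V.toAffine.Point, p • P = 0 → P = 0)
    (I : ZpExtension.EisensteinH1Data (κ.unitTwist (-1)) (fun k ↦ V.torsionGaloisModule ((p : ℤ) ^ k)) t hm) (σ k : ℕ)
    (hσ : k ≤ σ)
    (hle : shapiroIdeal p σ ≤ Ideal.span {(PowerSeries.X ^ m + PowerSeries.C (p : ℤ_[p]) : IwasawaAlgebra p)} ⊔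
      Ideal.span {PowerSeries.C ((p : ℤ_[p]) ^ k)}) (z : D.S) :
    galoisCohomology.map ((κ.unitTwist (-1)).shapiroToEisensteinTwistLe V hm σ k hσ hle) 1
        ((D.toShapiroLimitH1 t ht hts hγ hE z).1 σ) = I.proj k (D.toEisensteinH1 hm t ht I hγ hE z) := by
  rw [D.proj_toEisensteinH1 hm t ht I hγ hE z k (le_max_right σ _)]
  exact map_shapiroToEisensteinTwistLe_toShapiroLimitH1 t hm D ht hts hγ hE σ k _ hσ (le_max_left _ _)
    (le_max_right _ _) hle z

end Literature.NumberTheory.EllipticCurves.ZpExtension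

end
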